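import Mathlib
import HarnessLib
import Summits.Langlands.Langlands.Theses.SkinnerWilesDefectOne
import Summits.Langlands.Langlands.Theorems.ReducibleOrdinaryProModular.Negative.LevelAndRamification
import Literature.NumberTheory.GaloisRepresentations.NearlyOrdinaryDeformationRing
import Summits.Langlands.Langlands.Theorems.SkinnerWilesDefectOneReducibleOrdinaryProModularDefs
import Summits.Langlands.Langlands.Theorems.SkinnerWilesDefectOneProModularOfEisensteinSeedProModularPrimes

/-! # Specialisation toolkit for the Ihara crossing: helper file `…IharaCrossingSpecialisationAux` for stub
`stub_iharaCrossingLocal` of line steinberg-hyperplane (crux ReducibleOrdinaryProModular, stmt-Langlands-12919)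

The crossing stub `stub_iharaCrossingLocal` (S5') must end by pushing a PRO-MODULAR PRIME of the universal
nearly ordinary deformation ring `R_𝒟` of an oriented model `M` back to the `p`-adic representation `ρ`
classified by the specialisation `φ = M.φ : R_𝒟 → ℚ̄_p`.  This file proves, kernel-checked, everything of
that last step that does not depend on the patching argument:

* §1 generic plumbing: `continuous_ringHom_of_map_le_adic` (a ring map with `f(I) ⊆ J` is continuous for
  the adic topologies); `exists_valuation_pow_le_of_fg` (an integral ring map `f : R → ℚ̄_p` with
  `‖f‖ < 1` on a finitely generated ideal `I` has `‖f(Iⁿ)‖ ≤ cⁿ` for some `c < 1`);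
  `continuous_quotient_lift_adic` / `continuous_kerLift_adic_of_valuation` (hence every factorisation
  `R/𝔮 → ℚ̄_p` of `f`, in particular `R/ker f ↪ ℚ̄_p`, is continuous for the `I·(R/𝔮)`-adic topology);
* §2 **(B) continuity from locality**: for a model with `M.IsLocalPoint` (`‖φ r‖ ≤ 1`, `< 1` on `𝔪_R`;
  `𝔪_R` is finitely generated since `R_𝒟` is Noetherian) the induced map `R_𝒟/ker φ → ℚ̄_p` is
  continuous for the `𝔪_R`-adic topology (`ModelData.IsLocalPoint.continuous_kerLift`) — the datum
  the prime-level predicate `IsProModularPrimeAt` needs and `ModelData.Models` does not record;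
* §3 the audit of `IsProModularPrimeAt` (wave 1 of the line): `isProModularPrimeAt_iff_two` (unfolded to
  atoms, same normalisation as the landed `isPadicallyAutomorphic_iff`/`heckeFrobPoly_two`),
  `modPrime_eq_map_factor`, and `isPadicallyAutomorphic_of_isProModularPrimeAt`: the prime-level predicate
  specialises LITERALLY to the crux's `TameLevel.IsPadicallyAutomorphic` along any ring map `e : R/𝔮 → A`
  continuous from the `𝔪_R`-adic topology and any frame `P` with `GL₂(e) ∘ (ρ_𝒟 mod 𝔮) = P⁻¹ ρ' P`.
  Going up (`IsProModularPrimeAt.of_le`, SkinnerWiles1999 §4.1 "if `q` is pro-modular and `p ⊇ q` then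
  `p` is pro-modular") is the landed `Theorems/SkinnerWilesDefectOneProModularOfEisensteinSeedProModularPrimes`
  (imported, same namespace), together with `heckeFrobPoly_map`;
* §4 **(C) the reduction lemma** `ModelData.Models.isPadicallyAutomorphic_of_isProModularPrimeAt_ker`:
  `M.Models ρ ρ₀ S`, `M.IsLocalPoint` and pro-modularity of `𝔭_ρ := ker φ` at level `𝒰` give
  `𝒰.IsPadicallyAutomorphic ρ` (`Models.realizes` supplies the frame, (B) the continuity); and its corollary
  `…_of_le`: pro-modularity of ANY prime `𝔮 ⊆ ker φ` at `𝒰` suffices (going up first) — the form in which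
  the output of `C⁺`/patching ("the generic point of the component `C_ρ ∋ 𝔭_ρ` is pro-modular") is consumed;
  `…proMod_of_isProModularPrimeAt_le` concludes the crux's `ProMod p ρ`;
* §5 the REGISTERED wrapper `stub_iharaCrossingLocal_auxReduction` (sub-goal of stmt-Langlands-12919).

References: SkinnerWiles1999 §4.1 (4.1) and p. 62; GeeNewton2020 §3.3; the landed
`Theorems/ReducibleOrdinaryProModular/Negative/LevelAndRamification.lean`; the sibling skeleton's proved
`heckeExit` (`Cruxes/ReducibleOrdinaryProModular/Lines/generic_eisenstein_rigidity.lean`), whose continuity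
argument §1–§2 adapt to the quotient `R/ker φ`. -/

set_option linter.dupNamespace false
set_option autoImplicit false

namespace Summit.Langlands.Langlands.Cruxes.ReducibleOrdinaryProModular.SteinbergHyperplane

open scoped NumberField MatrixGroups NNReal
open Filter NumberField IsDedekindDomain Field Polynomial Matrix
open Literature.NumberTheory.Automorphic Literature.NumberTheory.Automorphic.BigHeckeGLn
open Literature.NumberTheory.GaloisRepresentations
open Summit.Langlands.Langlands.Theses.SkinnerWilesDefectOne
open Summit.Langlands.Langlands.Theorems.ReducibleOrdinaryProModular.Negative (heckeFrobPoly_two)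

noncomputable section

/-! ## 1. Generic plumbing: adic continuity -/

/-- A ring homomorphism `f : R → S` with `f(I) ⊆ J` is continuous for the `I`-adic topology on `R` and
the `J`-adic topology on `S` (`f(Iⁿ) ⊆ Jⁿ`). [folklore] -/
theorem continuous_ringHom_of_map_le_adic {R S : Type*} [CommRing R] [CommRing S] (I : Ideal R)
    (J : Ideal S) (f : R →+* S) (hf : I.map f ≤ J) :
    @Continuous R S I.adicTopology J.adicTopology f := by
  letI := I.adicTopology
  letI := J.adicTopology
  haveI := I.nonarchimedean
  haveI := J.nonarchimedean
  refine continuous_of_continuousAt_zero f ?_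
  rw [ContinuousAt, map_zero, I.hasBasis_nhds_zero_adic.tendsto_iff J.hasBasis_nhds_zero_adic]
  refine fun n _ => ⟨n, trivial, fun y hy => ?_⟩
  have h : (I.map f) ^ n ≤ J ^ n := Ideal.pow_right_mono hf n
  rw [← Ideal.map_pow] at h
  exact h (Ideal.mem_map_of_mem f hy)

/-- **Integral-local maps contract the powers of the ideal.**  If `f : R → ℚ̄_p` is a ring map with
`‖f r‖ ≤ 1` on `R` and `‖f r‖ < 1` on a finitely generated ideal `I`, then with `c < 1` the maximum of
`‖f s‖` over a finite generating set one has `‖f(Iⁿ)‖ ≤ cⁿ` for all `n` (ultrametric inequality and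
multiplicativity). [folklore] -/
theorem exists_valuation_pow_le_of_fg {R : Type*} [CommRing R] {p : ℕ} [Fact p.Prime]
    (f : R →+* PadicAlgCl p) {I : Ideal R} (hI : I.FG) (hint : ∀ r, Valued.v (f r) ≤ 1)
    (hloc : ∀ r ∈ I, Valued.v (f r) < 1) :
    ∃ c : ℝ≥0, c < 1 ∧ ∀ n : ℕ, ∀ r ∈ I ^ n, Valued.v (f r) ≤ c ^ n := by
  obtain ⟨Sfin, hS⟩ := hI
  set c : ℝ≥0 := Sfin.sup fun s => Valued.v (f s) with hc
  have hc1 : c < 1 := by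
    refine (Finset.sup_lt_iff (bot_lt_iff_ne_bot.mpr one_ne_zero)).mpr ?_
    intro s hs
    exact hloc s (hS ▸ Submodule.subset_span hs)
  have hm1 : ∀ r ∈ I, Valued.v (f r) ≤ c := by
    intro r hr
    rw [← hS] at hr
    induction hr using Submodule.span_induction with
    | mem x hx => exact Finset.le_sup (f := fun s => Valued.v (f s)) hx
    | zero => simp
    | add x x' _ _ hx hx' =>
      rw [map_add]
      exact (Valuation.map_add _ _ _).trans (max_le hx hx')
    | smul a x _ hx =>
      rw [smul_eq_mul, map_mul, Valuation.map_mul]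
      calc Valued.v (f a) * Valued.v (f x) ≤ 1 * c := mul_le_mul' (hint a) hx
        _ = c := one_mul c
  refine ⟨c, hc1, fun n => ?_⟩
  induction n with
  | zero =>
    intro r _
    simpa using hint r
  | succ n ih =>
    intro r hr
    rw [pow_succ] at hr
    refine Submodule.smul_induction_on hr ?_ ?_
    · intro m hm n' hn'
      rw [smul_eq_mul, map_mul, Valuation.map_mul, pow_succ]
      exact mul_le_mul' (ih m hm) (hm1 n' hn')
    · intro x x' hx hx'
      rw [map_add]
      exact (Valuation.map_add _ _ _).trans (max_le hx hx')

/-- **Continuity of a factorisation through a quotient.**  If `f : R → ℚ̄_p` is integral with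
`‖f‖ < 1` on the finitely generated ideal `I` and `g : R/𝔮 → ℚ̄_p` satisfies `g ∘ (R → R/𝔮) = f`, then
`g` is continuous for the `I·(R/𝔮)`-adic topology: `g((I·R/𝔮)ⁿ) = f(Iⁿ)` has norm `≤ cⁿ → 0`
(`Ideal.hasBasis_nhds_zero_adic`, `Ideal.mem_map_iff_of_surjective`). [folklore] -/
theorem continuous_quotient_lift_adic {R : Type*} [CommRing R] {p : ℕ} [Fact p.Prime]
    (f : R →+* PadicAlgCl p) {I : Ideal R} (hI : I.FG) (hint : ∀ r, Valued.v (f r) ≤ 1)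
    (hloc : ∀ r ∈ I, Valued.v (f r) < 1) (𝔮 : Ideal R) (g : R ⧸ 𝔮 →+* PadicAlgCl p)
    (hg : ∀ r, g (Ideal.Quotient.mk 𝔮 r) = f r) :
    @Continuous _ _ (I.map (Ideal.Quotient.mk 𝔮)).adicTopology inferInstance g := by
  obtain ⟨c, hc1, hcn⟩ := exists_valuation_pow_le_of_fg f hI hint hloc
  letI τ : TopologicalSpace (R ⧸ 𝔮) := (I.map (Ideal.Quotient.mk 𝔮)).adicTopology
  haveI := (I.map (Ideal.Quotient.mk 𝔮)).nonarchimedean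
  apply continuous_of_continuousAt_zero g
  rw [ContinuousAt, map_zero,
    (I.map (Ideal.Quotient.mk 𝔮)).hasBasis_nhds_zero_adic.tendsto_iff Metric.nhds_basis_ball]
  intro ε hε
  obtain ⟨n, hn⟩ := exists_pow_lt_of_lt_one hε (show ((c : ℝ≥0) : ℝ) < 1 by exact_mod_cast hc1)
  refine ⟨n, trivial, fun y hy => ?_⟩
  rw [← Ideal.map_pow] at hy
  obtain ⟨r, hr, rfl⟩ := (Ideal.mem_map_iff_of_surjective _ Ideal.Quotient.mk_surjective).mp hy
  rw [Metric.mem_ball, dist_zero_right, hg r]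
  calc ‖f r‖ = ((Valued.v (f r) : ℝ≥0) : ℝ) := rfl
    _ ≤ ((c ^ n : ℝ≥0) : ℝ) := by exact_mod_cast hcn n r hr
    _ = (c : ℝ) ^ n := by push_cast; rfl
    _ < ε := hn

/-- **The induced injection `R/ker f ↪ ℚ̄_p` of an integral map local on a finitely generated ideal `I`
is continuous** for the `I·(R/ker f)`-adic topology. [folklore] -/
theorem continuous_kerLift_adic_of_valuation {R : Type*} [CommRing R] {p : ℕ} [Fact p.Prime]
    (f : R →+* PadicAlgCl p) {I : Ideal R} (hI : I.FG) (hint : ∀ r, Valued.v (f r) ≤ 1)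
    (hloc : ∀ r ∈ I, Valued.v (f r) < 1) :
    @Continuous _ _ (I.map (Ideal.Quotient.mk (RingHom.ker f))).adicTopology inferInstance
      (RingHom.kerLift f) :=
  continuous_quotient_lift_adic f hI hint hloc (RingHom.ker f) (RingHom.kerLift f)
    (RingHom.kerLift_mk f)

/-! ## 2. (B) Continuity from locality of the point -/

section LocalPoint

variable {F : Type} [Field F] [NumberField F] {p : ℕ} [Fact p.Prime]

/-- **Continuity from locality.**  For a model `M` whose specialisation `φ : R_𝒟 → ℚ̄_p` is a local
integral point (`M.IsLocalPoint`: `‖φ r‖ ≤ 1`, and `< 1` on `𝔪_R`), the induced map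
`R_𝒟/ker φ → ℚ̄_p` is continuous for the `𝔪_R`-adic topology of `R_𝒟/ker φ` (`𝔪_R` is finitely
generated, `R_𝒟` being Noetherian; `‖φ(𝔪_Rⁿ)‖ ≤ cⁿ` with `c < 1`). [folklore] -/
theorem ModelData.IsLocalPoint.continuous_kerLift {M : ModelData F p} (hM : M.IsLocalPoint) :
    @Continuous _ _
      ((IsLocalRing.maximalIdeal M.𝓡.R).map (Ideal.Quotient.mk (RingHom.ker M.φ))).adicTopology
      inferInstance (RingHom.kerLift M.φ) :=
  continuous_kerLift_adic_of_valuation M.φ (IsNoetherian.noetherian _) hM.1 hM.2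

end LocalPoint

/-! ## 3. The audit of `IsProModularPrimeAt` (wave 1) -/

section Audit

variable {F : Type} [Field F] [NumberField F] {p : ℕ} [Fact p.Prime]
variable {𝒪 : Type} [CommRing 𝒪] {k : Type} [Field k] [Algebra 𝒪 k] {𝒟 : NearlyOrdinaryDatum F p 𝒪 k}
variable (𝓡 : NearlyOrdinaryDeformationRing.{0} 𝒟)

/-- **`IsProModularPrimeAt` unfolded to atoms** (rank two): a point `x : 𝕋(𝒰) → R/𝔮`, continuous for
the `𝔪_R`-adic topology of `R/𝔮`, with `ρ_𝒟 mod 𝔮` unramified off `𝒰.bad` and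
`charpoly (ρ_𝒟 mod 𝔮)(Frob_v) = X² − x(T_{v,1}) X + q_v x(T_{v,2})` for every arithmetic Frobenius —
the same atoms as the landed `isPadicallyAutomorphic_iff` + `heckeFrobPoly_two`. [folklore] -/
theorem isProModularPrimeAt_iff_two (𝒰 : TameLevel 2 F p) (𝔮 : PrimeSpectrum 𝓡.R) :
    IsProModularPrimeAt 𝓡 𝒰 𝔮 ↔
      ∃ x : CompletedCohomologyHeckeAlgebraGLn 𝒰 →+* 𝓡.R ⧸ 𝔮.asIdeal,
        @Continuous _ _ inferInstance
          ((IsLocalRing.maximalIdeal 𝓡.R).map (Ideal.Quotient.mk 𝔮.asIdeal)).adicTopology (⇑x) ∧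
        ∀ v ∉ 𝒰.bad, Deformation.IsUnramifiedAt v (𝓡.modPrime 𝔮) ∧
          ∀ 𝔓 ∈ v.primesAbove, ∀ σ : absoluteGaloisGroup F, IsArithFrobAt (𝓞 F) σ 𝔓 →
            (𝓡.modPrime 𝔮 σ).val.charpoly =
              X ^ 2 - C (x (𝒰.heckeT v 1)) * X +
                C ((Ideal.absNorm v.asIdeal : 𝓡.R ⧸ 𝔮.asIdeal) * x (𝒰.heckeT v 2)) := by
  simp only [IsProModularPrimeAt, heckeFrobPoly_two]

omit [Fact p.Prime] in
/-- Reduction modulo a larger prime factors through reduction modulo a smaller one (pointwise form of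
the landed `modPrime_eq_map_factor_comp`). [folklore] -/
theorem modPrime_eq_map_factor {𝔮 𝔮' : PrimeSpectrum 𝓡.R} (hle : 𝔮.asIdeal ≤ 𝔮'.asIdeal)
    (σ : absoluteGaloisGroup F) :
    𝓡.modPrime 𝔮' σ =
      Matrix.GeneralLinearGroup.map (Ideal.Quotient.factor hle) (𝓡.modPrime 𝔮 σ) := by
  rw [modPrime_eq_map_factor_comp 𝓡 hle, MonoidHom.comp_apply]

/-- **The prime-level predicate specialises literally to the crux's `IsPadicallyAutomorphic`.**  If `𝔮`
is pro-modular at level `𝒰`, `e : R/𝔮 → A` is a ring map CONTINUOUS from the `𝔪_R`-adic topology of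
`R/𝔮` to the topological ring `A` (e.g. `A = ℚ̄_p`, `e` induced by a local integral `φ : R → ℚ̄_p` with
`ker φ = 𝔮`, `ModelData.IsLocalPoint.continuous_kerLift`), and `ρ' : Γ_F → GL₂(A)` is a framed
representation with `GL₂(e) ∘ (ρ_𝒟 mod 𝔮) = P⁻¹ ρ' P`, then `ρ'` is `p`-adically automorphic of level
`𝒰`: same point composed with `e`, unramifiedness and Frobenius characteristic polynomials being
invariant under `GL₂(e)` and conjugation.  (Continuity of `e` is a genuine extra datum: it is not
recorded in `ModelData`/`Models`.) [folklore] -/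
theorem isPadicallyAutomorphic_of_isProModularPrimeAt {𝒰 : TameLevel 2 F p}
    {𝔮 : PrimeSpectrum 𝓡.R} (h : IsProModularPrimeAt 𝓡 𝒰 𝔮) {A : Type*} [CommRing A]
    [TopologicalSpace A] (e : 𝓡.R ⧸ 𝔮.asIdeal →+* A)
    (he : @Continuous _ _
      ((IsLocalRing.maximalIdeal 𝓡.R).map (Ideal.Quotient.mk 𝔮.asIdeal)).adicTopology
      inferInstance e)
    (ρ' : FramedGaloisRep F A 2) (P : GL (Fin 2) A)
    (hconj : ∀ g, Matrix.GeneralLinearGroup.map e (𝓡.modPrime 𝔮 g) = P⁻¹ * ρ' g * P) :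
    𝒰.IsPadicallyAutomorphic ρ' := by
  obtain ⟨x, hx, hass⟩ := h
  letI τ : TopologicalSpace (𝓡.R ⧸ 𝔮.asIdeal) :=
    ((IsLocalRing.maximalIdeal 𝓡.R).map (Ideal.Quotient.mk 𝔮.asIdeal)).adicTopology
  refine ⟨e.comp x, he.comp hx, fun v hv => ?_⟩
  obtain ⟨hunr, hchar⟩ := hass v hv
  refine ⟨fun 𝔓 h𝔓 σ hσ => ?_, fun 𝔓 h𝔓 σ hσ => ?_⟩
  · have h1 := hconj σ
    rw [hunr 𝔓 h𝔓 σ hσ, map_one] at h1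
    calc ρ' σ = P * (P⁻¹ * ρ' σ * P) * P⁻¹ := by group
      _ = 1 := by rw [← h1]; group
  · have h1 : ρ' σ = P * Matrix.GeneralLinearGroup.map e (𝓡.modPrime 𝔮 σ) * P⁻¹ := by
      rw [hconj σ]; group
    have h2 : ((Matrix.GeneralLinearGroup.map e (𝓡.modPrime 𝔮 σ) : GL (Fin 2) A) :
        Matrix (Fin 2) (Fin 2) A) = (𝓡.modPrime 𝔮 σ).val.map e := rfl
    show Matrix.charpoly ((ρ' σ : GL (Fin 2) A) : Matrix (Fin 2) (Fin 2) A) = _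
    rw [h1, Units.val_mul, Units.val_mul, Matrix.coe_units_inv, Matrix.charpoly_units_conj, h2,
      Matrix.charpoly_map, hchar 𝔓 h𝔓 σ hσ, heckeFrobPoly_map]
    rfl

end Audit

/-! ## 4. (C) The reduction of the crossing to a pro-modular prime below the point -/

section Reduction

variable {F : Type} [Field F] [NumberField F] {p : ℕ} [Fact p.Prime]

/-- `GL₂(kerLift φ) ∘ (ρ_𝒟 mod ker φ) = GL₂(φ) ∘ ρ_𝒟` (`kerLift φ ∘ mk = φ`). [folklore] -/
theorem ModelData.map_kerLift_modPrime (M : ModelData F p) (g : absoluteGaloisGroup F) :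
    Matrix.GeneralLinearGroup.map (RingHom.kerLift M.φ)
        (M.𝓡.modPrime ⟨RingHom.ker M.φ, RingHom.ker_isPrime M.φ⟩ g) =
      Matrix.GeneralLinearGroup.map M.φ (M.𝓡.ρ g) :=
  Matrix.GeneralLinearGroup.ext fun _ _ => rfl

variable {O : ValuationSubring (PadicAlgCl p)} {ρ : FramedGaloisRep F (PadicAlgCl p) 2}
  {ρ₀ : absoluteGaloisGroup F →* GL (Fin 2) O} {S : Set (HeightOneSpectrum (𝓞 F))}
  {M : ModelData F p}

/-- **The reduction lemma: the crossing reduces to pro-modularity of the point's prime.**  If `M`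
models `(ρ, ρ₀)` (so `GL₂(φ) ∘ ρ_𝒟 = P⁻¹ ρ P`, `Models.realizes`), `φ` is a local integral point and
the prime `𝔭_ρ = ker φ` of `R_𝒟` is pro-modular at the tame level `𝒰`, then `ρ` is `p`-adically
automorphic of level `𝒰`: push the continuous point `𝕋(𝒰) → R/ker φ` along the continuous injection
`R/ker φ ↪ ℚ̄_p` (§2); unramifiedness and Frobenius polynomials are carried along
(`isPadicallyAutomorphic_of_isProModularPrimeAt`). [folklore] -/
theorem ModelData.Models.isPadicallyAutomorphic_of_isProModularPrimeAt_ker (hM : M.Models ρ ρ₀ S)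
    (hloc : M.IsLocalPoint) {𝒰 : TameLevel 2 F p}
    (h : IsProModularPrimeAt M.𝓡 𝒰 ⟨RingHom.ker M.φ, RingHom.ker_isPrime M.φ⟩) :
    𝒰.IsPadicallyAutomorphic ρ := by
  obtain ⟨P, hP⟩ := hM.realizes
  exact isPadicallyAutomorphic_of_isProModularPrimeAt M.𝓡 h (RingHom.kerLift M.φ)
    hloc.continuous_kerLift ρ P fun g => by rw [M.map_kerLift_modPrime g, hP g]

/-- **Pro-modularity of ANY prime below the point suffices** (going up, SkinnerWiles1999 §4.1, then the
reduction lemma): if some prime `𝔮 ⊆ ker φ` of `R_𝒟` is pro-modular at level `𝒰` — e.g. the generic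
point of the component `C_ρ ∋ 𝔭_ρ` produced by patching — then `ρ` is `p`-adically automorphic of
level `𝒰`. [folklore] -/
theorem ModelData.Models.isPadicallyAutomorphic_of_isProModularPrimeAt_le (hM : M.Models ρ ρ₀ S)
    (hloc : M.IsLocalPoint) {𝒰 : TameLevel 2 F p} {𝔮 : PrimeSpectrum M.𝓡.R}
    (hle : 𝔮.asIdeal ≤ RingHom.ker M.φ) (h : IsProModularPrimeAt M.𝓡 𝒰 𝔮) :
    𝒰.IsPadicallyAutomorphic ρ :=
  hM.isPadicallyAutomorphic_of_isProModularPrimeAt_ker hloc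
    (IsProModularPrimeAt.of_le M.𝓡 (𝔭 := ⟨RingHom.ker M.φ, RingHom.ker_isPrime M.φ⟩)
      ((PrimeSpectrum.asIdeal_le_asIdeal 𝔮 _).mp hle) h)

/-- **The crux's conclusion from a pro-modular prime below the point**: under `M.Models ρ ρ₀ S` and
`M.IsLocalPoint`, a prime `𝔮 ⊆ ker φ` pro-modular at some tame level gives `ProMod p ρ`. [folklore] -/
theorem ModelData.Models.proMod_of_isProModularPrimeAt_le (hM : M.Models ρ ρ₀ S)
    (hloc : M.IsLocalPoint) {𝒰 : TameLevel 2 F p} {𝔮 : PrimeSpectrum M.𝓡.R}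
    (hle : 𝔮.asIdeal ≤ RingHom.ker M.φ) (h : IsProModularPrimeAt M.𝓡 𝒰 𝔮) : ProMod p ρ :=
  ⟨𝒰, hM.isPadicallyAutomorphic_of_isProModularPrimeAt_le hloc hle h⟩

end Reduction

/-! ## 5. The registered wrapper -/

/-- **Registered sub-goal `stub_iharaCrossingLocal_auxReduction` of stmt-Langlands-12919** (helper for the
crossing stub `stub_iharaCrossingLocal`): for a model `M` of `(ρ, ρ₀)` at any level `S` whose
specialisation is a local integral point, pro-modularity at the tame level `𝒰` of any prime `𝔮 ⊆ ker φ`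
of `R_𝒟` gives `𝒰.IsPadicallyAutomorphic ρ` — the crossing is thereby reduced to producing ONE
pro-modular prime below the point `𝔭_ρ`. [folklore] -/
theorem stub_iharaCrossingLocal_auxReduction :
    ∀ (F : Type) [Field F] [NumberField F] (p : ℕ) [Fact p.Prime] (O : ValuationSubring (PadicAlgCl p)) (ρ : FramedGaloisRep F (PadicAlgCl p) 2) (ρ₀ : absoluteGaloisGroup F →* GL (Fin 2) O) (S : Set (HeightOneSpectrum (𝓞 F))) (M : ModelData F p) (𝒰 : TameLevel 2 F p) (𝔮 : PrimeSpectrum M.𝓡.R), M.Models ρ ρ₀ S → M.IsLocalPoint → 𝔮.asIdeal ≤ RingHom.ker M.φ → IsProModularPrimeAt M.𝓡 𝒰 𝔮 → 𝒰.IsPadicallyAutomorphic ρ :=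
  fun _ _ _ _ _ _ _ _ _ _ _ _ hM hloc hle h => hM.isPadicallyAutomorphic_of_isProModularPrimeAt_le hloc hle h

end

end Summit.Langlands.Langlands.Cruxes.ReducibleOrdinaryProModular.SteinbergHyperplane
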